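import Mathlib
import Literature.NumberTheory.LFunctions.Zhang2022.Section15BCoprimeLocalEstimate
import HarnessLib

/-!
# Zhang (2022), §15 p. 84: "`ℳ₁(d,l;s) ≪ ∏_{q∣dl}(1 + cq^{−9/10})` for `σ > 9/10`" (§15.u035) — PROVED

Topic `Literature/NumberTheory/LFunctions/Zhang2022` (Landau–Siegel audit tree; verdict-neutral).
Y. Zhang, *Discrete mean estimates and the Landau–Siegel zero*, arXiv:2211.02515v1 (2022)
[Zhang2022LandauSiegel] — **an unrefereed manuscript under adjudication**. The typed CLAIM node
`Typed.Section15B.Step15_u035` (DAG `Z22:§15.u035`, tex L4209; a frontier leaf of the whole-DAG theorem,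
binder `h15u035` of `theorem1_of_leaves_v18`) is discharged OUTRIGHT from the tree's local estimates:

* §15.u032 (`step15_u032_holds`, `Section15BCoprimeLocalEstimate`): `‖factor_q − 1‖ ≤ C₂q^{−19/10}` for
  `(q,dl) = 1`; §15.u033 (`step15_u033_holds`, `Section15BLocalEstimates`): `‖factor_q − 1‖ ≤ C₃q^{−9/10}`
  for `q ∣ dl`; §15.u034 analytic clause (`step15_u034an_holds`): the Euler product
  `ℳ₁(d,l;s) = ∏'_q factor_q` converges on `σ > 9/10`.
* Hence every finite partial product has norm `≤ ∏(1 + ‖factor_q − 1‖) ≤ exp(C₂Σ_q q^{−19/10}) ·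
  ∏_{q∣dl}(1 + C₃q^{−9/10})`, and the bound passes to the limit: `step15_u035_of`, `step15_u035_holds`
  with `c := max C₃ 0`, `C := exp(max C₂ 0 · Σ'_q q^{−19/10})` (absolute constants).

Nothing about Theorems 1–2 of the source is implied; nothing here bears on the verdict on (8.24).

## References

* Y. Zhang, arXiv:2211.02515v1 (2022), §15 p. 84, tex L4195–L4212. [cite: Zhang2022LandauSiegel, §15 p. 84]
-/

noncomputable section

open Complex Real Filter Topology

namespace Literature.NumberTheory.LFunctions.Zhang2022.Typed.Section15B

open Literature.NumberTheory.LFunctions.Zhang2022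
open Literature.NumberTheory.LFunctions.Zhang2022.Skeleton

/-- `‖∏_{i∈A} F i‖ ≤ ∏_{i∈A} (1 + ‖F i − 1‖)`. [folklore] -/
private theorem norm_prod_le_prod_one_add_norm_sub_one {ι : Type*} (A : Finset ι) (F : ι → ℂ) :
    ‖∏ i ∈ A, F i‖ ≤ ∏ i ∈ A, (1 + ‖F i - 1‖) := by
  rw [norm_prod]
  refine Finset.prod_le_prod (fun i _ => norm_nonneg _) fun i _ => ?_
  calc ‖F i‖ = ‖(F i - 1) + 1‖ := by rw [sub_add_cancel]
    _ ≤ ‖F i - 1‖ + ‖(1 : ℂ)‖ := norm_add_le _ _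
    _ = 1 + ‖F i - 1‖ := by rw [norm_one, add_comm]

/-- `∏_{i∈A} (1 + x i) ≤ exp (Σ_{i∈A} x i)` for `x ≥ 0`. [folklore] -/
private theorem prod_one_add_le_exp_sum {ι : Type*} (A : Finset ι) {x : ι → ℝ} (hx : ∀ i, 0 ≤ x i) :
    ∏ i ∈ A, (1 + x i) ≤ Real.exp (∑ i ∈ A, x i) := by
  rw [Real.exp_sum]
  exact Finset.prod_le_prod (fun i _ => by linarith [hx i]) fun i _ => by
    linarith [Real.add_one_le_exp (x i)]

/-- `1 ≤ ∏_{i∈s} f i` when every `f i ≥ 1` (real version). [folklore] -/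
private theorem one_le_prod_real {ι : Type*} (s : Finset ι) {f : ι → ℝ} (h : ∀ i ∈ s, 1 ≤ f i) :
    1 ≤ ∏ i ∈ s, f i :=
  calc (1 : ℝ) = ∏ _i ∈ s, (1 : ℝ) := Finset.prod_const_one.symm
    _ ≤ ∏ i ∈ s, f i := Finset.prod_le_prod (fun _ _ => zero_le_one) h

/-- A sub-product of factors `≥ 1` is bounded by the full product (real version). [folklore] -/
private theorem prod_le_prod_of_subset_of_one_le_real {ι : Type*} [DecidableEq ι] {s t : Finset ι}
    (hst : s ⊆ t) {f : ι → ℝ} (h1 : ∀ i ∈ t, 1 ≤ f i) : ∏ i ∈ s, f i ≤ ∏ i ∈ t, f i := by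
  rw [← Finset.prod_sdiff hst]
  have hs0 : 0 ≤ ∏ i ∈ s, f i := Finset.prod_nonneg fun i hi => zero_le_one.trans (h1 i (hst hi))
  have h := one_le_prod_real (t \ s) (f := f) fun i hi => h1 i (Finset.mem_sdiff.mp hi).1
  exact le_mul_of_one_le_left hs0 h

/-- **§15.u035 from §15.u032, §15.u033 and the convergence of the Euler product (§15.u034)**
(DAG `Z22:§15.u035` ⇐ `Z22:§15.u032` + `Z22:§15.u033` + `Z22:§15.u034`): for all large `D` under (A),
`d, l ≥ 1` and `σ > 9/10`, `‖ℳ₁(d,l;s)‖ ≤ C ∏_{q∣dl}(1 + c q^{−9/10})` with the absolute constants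
`c = max C₃ 0`, `C = exp(max C₂ 0 · Σ'_q q^{−19/10})`. [cite: Zhang2022LandauSiegel, §15 p. 84] -/
theorem step15_u035_of (c' : ℝ) (h32 : Step15_u032 c') (h33 : Step15_u033 c')
    (h34 : Step15_u034an c') : Step15_u035 c' := by
  classical
  obtain ⟨C₂, h32⟩ := h32
  obtain ⟨C₃, h33⟩ := h33
  set C₂' : ℝ := max C₂ 0 with hC₂'
  set C₃' : ℝ := max C₃ 0 with hC₃'
  have hC₂'0 : 0 ≤ C₂' := le_max_right _ _
  have hC₃'0 : 0 ≤ C₃' := le_max_right _ _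
  -- the global majorant over the primes and the global constant
  set x : Nat.Primes → ℝ := fun q => C₂' * ((q : ℕ) : ℝ) ^ (-(19 / 10 : ℝ)) with hxdef
  have hx0 : ∀ q, 0 ≤ x q := fun q => by positivity
  have hxsum : Summable x := by
    have h : Summable fun n : ℕ => (n : ℝ) ^ (-(19 / 10 : ℝ)) :=
      Real.summable_nat_rpow.mpr (by norm_num)
    exact (h.comp_injective Subtype.val_injective).mul_left C₂'
  set K : ℝ := Real.exp (∑' q, x q) with hK
  refine ⟨C₃', K, ?_⟩
  obtain ⟨D₀, hD₀⟩ := (h32.and h33).and h34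
  refine ⟨D₀, fun D _ χ hD hq hp hA d l hd hl s hs => ?_⟩
  obtain ⟨⟨e32, e33⟩, e34⟩ := hD₀ D χ hD hq hp
  have hdl0 : 0 < d * l := Nat.mul_pos hd hl
  obtain ⟨hmul, -⟩ := e34 hA d l hd hl
  set F : Nat.Primes → ℂ := fun q => calM1Factor c' χ (q : ℕ) d l s with hF
  have hHP : HasProd F (calM1 c' χ d l s) := (hmul s hs).hasProd
  -- the local majorants
  set y : Nat.Primes → ℝ := fun q =>
    if (q : ℕ) ∣ d * l then C₃' * ((q : ℕ) : ℝ) ^ (-(9 / 10 : ℝ)) else 0 with hydef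
  have hy0 : ∀ q, 0 ≤ y q := fun q => by
    simp only [hydef]; split_ifs <;> positivity
  have hFb : ∀ q : Nat.Primes, ‖F q - 1‖ ≤ x q + y q := by
    intro q
    have hqprime : (q : ℕ).Prime := q.prop
    have hq0 : (0 : ℝ) < ((q : ℕ) : ℝ) := by exact_mod_cast hqprime.pos
    by_cases hc : Nat.Coprime (q : ℕ) (d * l)
    · have h := e32 hA (q : ℕ) d l hqprime hd hl hc s hs
      have h' : ‖F q - 1‖ ≤ x q :=
        h.trans (mul_le_mul_of_nonneg_right (le_max_left _ _) (Real.rpow_nonneg hq0.le _))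
      linarith [hy0 q]
    · have h := e33 hA (q : ℕ) d l hqprime hd hl hc s hs
      have hdvd : (q : ℕ) ∣ d * l := not_not.mp (mt hqprime.coprime_iff_not_dvd.mpr hc)
      have h' : ‖F q - 1‖ ≤ y q := by
        simp only [hydef, if_pos hdvd]
        exact h.trans (mul_le_mul_of_nonneg_right (le_max_left _ _) (Real.rpow_nonneg hq0.le _))
      linarith [hx0 q]
  -- the target bound
  set Pdl : ℝ := ∏ q ∈ (d * l).primeFactors, (1 + C₃' * (q : ℝ) ^ (-(9 / 10 : ℝ))) with hPdl
  set B : ℝ := K * Pdl with hB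
  -- every finite partial product is bounded by `B`
  have hAll : ∀ A : Finset Nat.Primes, ‖∏ q ∈ A, F q‖ ≤ B := by
    intro A
    have h1 : ‖∏ q ∈ A, F q‖ ≤ ∏ q ∈ A, (1 + (x q + y q)) :=
      (norm_prod_le_prod_one_add_norm_sub_one A F).trans
        (Finset.prod_le_prod (fun q _ => by positivity) fun q _ => by linarith [hFb q])
    have h2 : ∏ q ∈ A, (1 + (x q + y q)) ≤ (∏ q ∈ A, (1 + x q)) * ∏ q ∈ A, (1 + y q) := by
      rw [← Finset.prod_mul_distrib]
      exact Finset.prod_le_prod (fun q _ => by linarith [hx0 q, hy0 q]) fun q _ => by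
        nlinarith [hx0 q, hy0 q]
    have h3 : ∏ q ∈ A, (1 + x q) ≤ K := by
      refine (prod_one_add_le_exp_sum A hx0).trans ?_
      rw [hK]
      exact Real.exp_le_exp.mpr (hxsum.sum_le_tsum A fun q _ => hx0 q)
    have h4 : ∏ q ∈ A, (1 + y q) ≤ Pdl := by
      -- `∏_{q∈A}(1 + y q) = ∏_{q∈A, q∣dl} g q`, and `{q ∈ A : q ∣ dl} ↪ (dl).primeFactors`, `g ≥ 1`
      set g : ℕ → ℝ := fun n => 1 + C₃' * (n : ℝ) ^ (-(9 / 10 : ℝ)) with hg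
      have hg1 : ∀ n, 1 ≤ g n := fun n => by
        have : 0 ≤ C₃' * (n : ℝ) ^ (-(9 / 10 : ℝ)) := by positivity
        simp only [hg]; linarith
      set A' : Finset Nat.Primes := A.filter (fun q : Nat.Primes => (q : ℕ) ∣ d * l) with hA'
      have hrw : ∏ q ∈ A, (1 + y q) = ∏ q ∈ A', g q := by
        rw [hA', Finset.prod_filter]
        refine Finset.prod_congr rfl fun q _ => ?_
        by_cases hqd : (q : ℕ) ∣ d * l
        · simp only [hydef, hg, if_pos hqd]
        · simp only [hydef, hg, if_neg hqd, add_zero]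
      have himg : ∏ n ∈ A'.image (fun q : Nat.Primes => (q : ℕ)), g n = ∏ q ∈ A', g q :=
        Finset.prod_image fun q _ q' _ h => Subtype.val_injective h
      have hsub : A'.image (fun q : Nat.Primes => (q : ℕ)) ⊆ (d * l).primeFactors := by
        intro n hn
        obtain ⟨q, hq', rfl⟩ := Finset.mem_image.mp hn
        exact Nat.mem_primeFactors.mpr ⟨q.prop, (Finset.mem_filter.mp hq').2, hdl0.ne'⟩
      calc ∏ q ∈ A, (1 + y q) = ∏ q ∈ A', g q := hrw
        _ = ∏ n ∈ A'.image (fun q : Nat.Primes => (q : ℕ)), g n := himg.symm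
        _ ≤ ∏ n ∈ (d * l).primeFactors, g n :=
            prod_le_prod_of_subset_of_one_le_real hsub fun n _ => hg1 n
        _ = Pdl := by rw [hPdl]
    have hK0 : 0 ≤ K := (Real.exp_pos _).le
    have hP1 : 0 ≤ ∏ q ∈ A, (1 + y q) := Finset.prod_nonneg fun q _ => by linarith [hy0 q]
    calc ‖∏ q ∈ A, F q‖ ≤ (∏ q ∈ A, (1 + x q)) * ∏ q ∈ A, (1 + y q) := h1.trans h2
      _ ≤ K * Pdl := mul_le_mul h3 h4 hP1 hK0
  -- pass to the limit of the unconditional product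
  have hT : Tendsto (fun A : Finset Nat.Primes => ∏ q ∈ A, F q) atTop (𝓝 (calM1 c' χ d l s)) := hHP
  have hclosed : IsClosed {z : ℂ | ‖z‖ ≤ B} := isClosed_le continuous_norm continuous_const
  have hmem := hclosed.mem_of_tendsto hT (Filter.Eventually.of_forall hAll)
  simpa only [hB, hPdl, Set.mem_setOf_eq] using hmem

/-- **§15.u035 holds outright** (DAG `Z22:§15.u035`): `step15_u035_of` fed with the tree theorems
`step15_u032_holds`, `step15_u033_holds`, `step15_u034an_holds` — the frontier leaf `h15u035` of the
whole-DAG theorem is DISCHARGED. [cite: Zhang2022LandauSiegel, §15 p. 84] -/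
theorem step15_u035_holds (c' : ℝ) : Step15_u035 c' :=
  step15_u035_of c' (step15_u032_holds c') (step15_u033_holds c') (step15_u034an_holds c')

variable (c' : ℝ) in
/-- `Step15_u035` — `_holds` alias of `step15_u035_holds` above under the fact's exact name, stated under the
prover's own binders as section variables (appended 2026-08-28, D-0026 bookkeeping: the proof term is the
existing theorem of this file; no statement, definition or attribute is edited; no new named fact; the
ledger's debt table listed the fact unproved). [cite: Zhang2022LandauSiegel, §15 p. 84] -/
theorem _root_.Literature.NumberTheory.LFunctions.Zhang2022.Typed.Section15B.Step15_u035_holds :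
    _root_.Literature.NumberTheory.LFunctions.Zhang2022.Typed.Section15B.Step15_u035 c' :=
  _root_.Literature.NumberTheory.LFunctions.Zhang2022.Typed.Section15B.step15_u035_holds (c' := c')

end Literature.NumberTheory.LFunctions.Zhang2022.Typed.Section15B
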